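import Mathlib.Analysis.SpecialFunctions.Complex.Circle
import Mathlib.Analysis.Complex.Trigonometric
import Mathlib.Geometry.Manifold.Complex
import Mathlib.Data.Finset.NatAntidiagonal
import Mathlib.Analysis.Complex.Basic
import Mathlib.LinearAlgebra.Complex.Module
import Summits.Ventures.HodgeRepro2.HostAPI.Carriers.NumberTheory.Transcendental.FormsAlgebra
import Summits.Ventures.HodgeRepro2.HostAPI.Carriers.Geometry.Kaehler.ManifoldForms
import Summits.Ventures.HodgeRepro2.HostAPI.Carriers.Geometry.Kaehler.Kaehler
import Summits.Ventures.HodgeRepro2.HostAPI.Util.ForallBinderLint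
open HostAPI.Carriers

noncomputable section

open scoped Manifold ContDiff Topology
open Bundle Set Finset

namespace HostAPI.Carriers.NumberTheory.Transcendental

variable {E : Type*} [NormedAddCommGroup E] [NormedSpace ℂ E]
  {M : Type*} [TopologicalSpace M] [ChartedSpace E M] {k l : ℕ}

variable (E) in

def tangentRotate (x : M) (θ : ℝ) : TangentSpace 𝓘(ℝ, E) x →L[ℝ] TangentSpace 𝓘(ℝ, E) x :=
  ((Complex.exp (θ * Complex.I) • ContinuousLinearMap.id ℂ E).restrictScalars ℝ : E →L[ℝ] E)

theorem tangentRotate_apply (x : M) (θ : ℝ) (v : TangentSpace 𝓘(ℝ, E) x) :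
    tangentRotate E x θ v = (letI V : E := v; Complex.exp (θ * Complex.I) • V) :=
  rfl

theorem tangentRotate_eq_cos_add_sin_tangentJ (x : M) (θ : ℝ) (v : TangentSpace 𝓘(ℝ, E) x) :
    tangentRotate E x θ v = Real.cos θ • v + Real.sin θ • HostAPI.Carriers.Geometry.Kaehler.tangentJ E x v := by
  change (Complex.exp (θ * Complex.I) • (show E from v) : E) =
    (Real.cos θ • (show E from v) + Real.sin θ • (Complex.I • (show E from v)) : E)
  rw [Complex.exp_mul_I, ← Complex.ofReal_cos, ← Complex.ofReal_sin, add_smul, mul_smul,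
    Complex.coe_smul, Complex.coe_smul]

@[simp]
theorem tangentRotate_zero_apply (x : M) (v : TangentSpace 𝓘(ℝ, E) x) :
    tangentRotate E x 0 v = v := by
  change (Complex.exp ((0 : ℝ) * Complex.I) • (show E from v) : E) = (show E from v)
  simp

section MForm
open HostAPI.Carriers.Geometry.Kaehler (MForm)
open HostAPI.Carriers.Geometry.Kaehler.MForm

def _root_.HostAPI.Carriers.Geometry.Kaehler.MForm.weightComponent (w : ℤ) (α : MForm 𝓘(ℝ, E) M ℂ k) : MForm 𝓘(ℝ, E) M ℂ k :=
  fun x ↦ ((2 * k + 1 : ℕ) : ℂ)⁻¹ • ∑ j : Fin (2 * k + 1),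
    Complex.exp (-(w * (2 * Real.pi * j / (2 * k + 1)) : ℝ) * Complex.I) •
      (α x).compContinuousLinearMap (tangentRotate E x (2 * Real.pi * j / (2 * k + 1)))

def _root_.HostAPI.Carriers.Geometry.Kaehler.MForm.typeComponent (p q : ℕ) (α : MForm 𝓘(ℝ, E) M ℂ k) : MForm 𝓘(ℝ, E) M ℂ k :=
  if p + q = k then α.weightComponent (p - q : ℤ) else 0

theorem _root_.HostAPI.Carriers.Geometry.Kaehler.MForm.typeComponent_of_ne {p q : ℕ} (h : p + q ≠ k) (α : MForm 𝓘(ℝ, E) M ℂ k) :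
    α.typeComponent p q = 0 := by
  simp [typeComponent, h]

@[simp]
theorem _root_.HostAPI.Carriers.Geometry.Kaehler.MForm.weightComponent_zero (w : ℤ) : (0 : MForm 𝓘(ℝ, E) M ℂ k).weightComponent w = 0 := by
  funext x; ext v; simp [weightComponent]

theorem _root_.HostAPI.Carriers.Geometry.Kaehler.MForm.weightComponent_add (w : ℤ) (α β : MForm 𝓘(ℝ, E) M ℂ k) :
    (α + β).weightComponent w = α.weightComponent w + β.weightComponent w := by
  funext x; ext v
  simp [weightComponent, Finset.sum_add_distrib, mul_add, Finset.mul_sum]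

theorem _root_.HostAPI.Carriers.Geometry.Kaehler.MForm.weightComponent_smul (w : ℤ) (c : ℂ) (α : MForm 𝓘(ℝ, E) M ℂ k) :
    (c • α).weightComponent w = c • α.weightComponent w := by
  funext x; ext v
  simp only [weightComponent, Pi.smul_apply, ContinuousAlternatingMap.smul_apply,
    ContinuousAlternatingMap.sum_apply, ContinuousAlternatingMap.compContinuousLinearMap_apply,
    smul_eq_mul, Finset.mul_sum]
  exact Finset.sum_congr rfl fun j _ ↦ by ring

theorem _root_.HostAPI.Carriers.Geometry.Kaehler.MForm.typeComponent_add (p q : ℕ) (α β : MForm 𝓘(ℝ, E) M ℂ k) :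
    (α + β).typeComponent p q = α.typeComponent p q + β.typeComponent p q := by
  unfold typeComponent
  split_ifs <;> simp [weightComponent_add]

theorem _root_.HostAPI.Carriers.Geometry.Kaehler.MForm.typeComponent_smul (p q : ℕ) (c : ℂ) (α : MForm 𝓘(ℝ, E) M ℂ k) :
    (c • α).typeComponent p q = c • α.typeComponent p q := by
  unfold typeComponent
  split_ifs <;> simp [weightComponent_smul]

@[simp]
theorem _root_.HostAPI.Carriers.Geometry.Kaehler.MForm.typeComponent_zero (p q : ℕ) : (0 : MForm 𝓘(ℝ, E) M ℂ k).typeComponent p q = 0 := by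
  unfold typeComponent
  split_ifs <;> simp

end MForm

def IsOfType (p q : ℕ) (α : HostAPI.Carriers.Geometry.Kaehler.MForm 𝓘(ℝ, E) M ℂ k) : Prop :=
  p + q = k ∧ ∀ (x : M) (θ : ℝ) (v : Fin k → TangentSpace 𝓘(ℝ, E) x),
    α x (fun i ↦ tangentRotate E x θ (v i)) =
      Complex.exp (((p : ℤ) - q : ℤ) * θ * Complex.I) * α x v

theorem IsOfType.add_eq {p q : ℕ} {α : HostAPI.Carriers.Geometry.Kaehler.MForm 𝓘(ℝ, E) M ℂ k} (h : IsOfType p q α) : p + q = k :=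
  h.1

theorem isOfType_zero {p q : ℕ} (h : p + q = k) : IsOfType p q (0 : HostAPI.Carriers.Geometry.Kaehler.MForm 𝓘(ℝ, E) M ℂ k) :=
  ⟨h, fun x θ v ↦ by simp⟩

theorem IsOfType.add {p q : ℕ} {α β : HostAPI.Carriers.Geometry.Kaehler.MForm 𝓘(ℝ, E) M ℂ k} (hα : IsOfType p q α)
    (hβ : IsOfType p q β) : IsOfType p q (α + β) :=
  ⟨hα.1, fun x θ v ↦ by
    simp only [Pi.add_apply, ContinuousAlternatingMap.add_apply, hα.2 x θ v, hβ.2 x θ v, mul_add]⟩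

theorem IsOfType.smul {p q : ℕ} (c : ℂ) {α : HostAPI.Carriers.Geometry.Kaehler.MForm 𝓘(ℝ, E) M ℂ k} (hα : IsOfType p q α) :
    IsOfType p q (c • α) :=
  ⟨hα.1, fun x θ v ↦ by
    simp only [Pi.smul_apply, ContinuousAlternatingMap.smul_apply, hα.2 x θ v, smul_eq_mul]
    ring⟩

theorem IsOfType.neg {p q : ℕ} {α : HostAPI.Carriers.Geometry.Kaehler.MForm 𝓘(ℝ, E) M ℂ k} (hα : IsOfType p q α) :
    IsOfType p q (-α) := by
  simpa using hα.smul (-1)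

def typeComponent_typeComponent : Prop :=
  ∀ (p q p' q' : ℕ) (α : HostAPI.Carriers.Geometry.Kaehler.MForm 𝓘(ℝ, E) M ℂ k),
    (α.typeComponent p q).typeComponent p' q' =
      if p = p' ∧ q = q' then α.typeComponent p q else 0

def typeComponent_typeComponent_self : Prop :=
  ∀ (p q : ℕ) (α : HostAPI.Carriers.Geometry.Kaehler.MForm 𝓘(ℝ, E) M ℂ k),
    (α.typeComponent p q).typeComponent p q = α.typeComponent p q

def sum_antidiagonal_typeComponent : Prop :=
  ∀ (α : HostAPI.Carriers.Geometry.Kaehler.MForm 𝓘(ℝ, E) M ℂ k),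
    ∑ pq ∈ antidiagonal k, α.typeComponent pq.1 pq.2 = α

def isOfType_typeComponent : Prop :=
  ∀ {p q : ℕ} (h : p + q = k) (α : HostAPI.Carriers.Geometry.Kaehler.MForm 𝓘(ℝ, E) M ℂ k),
    IsOfType p q (α.typeComponent p q)

def isOfType_iff_typeComponent_eq_self : Prop :=
  ∀ {p q : ℕ} (h : p + q = k) (α : HostAPI.Carriers.Geometry.Kaehler.MForm 𝓘(ℝ, E) M ℂ k),
    IsOfType p q α ↔ α.typeComponent p q = α

def IsOfType.typeComponent_of_ne : Prop :=
  ∀ {p q p' q' : ℕ} {α : HostAPI.Carriers.Geometry.Kaehler.MForm 𝓘(ℝ, E) M ℂ k} (hα : IsOfType p q α) (h : p ≠ p' ∨ q ≠ q'),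
    α.typeComponent p' q' = 0

def IsOfType.wedge : Prop :=
  ∀ {p q p' q' : ℕ} {α : HostAPI.Carriers.Geometry.Kaehler.MForm 𝓘(ℝ, E) M ℂ k} {β : HostAPI.Carriers.Geometry.Kaehler.MForm 𝓘(ℝ, E) M ℂ l} (hα : IsOfType p q α) (hβ : IsOfType p' q' β),
    IsOfType (p + p') (q + q') (α.wedge β)

section MForm
open HostAPI.Carriers.Geometry.Kaehler (MForm)
open HostAPI.Carriers.Geometry.Kaehler.MForm

def _root_.HostAPI.Carriers.Geometry.Kaehler.MForm.conj (α : MForm 𝓘(ℝ, E) M ℂ k) : MForm 𝓘(ℝ, E) M ℂ k := fun x ↦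
  (Complex.conjCLE : ℂ →L[ℝ] ℂ).compContinuousAlternatingMap (α x)

@[simp]
theorem _root_.HostAPI.Carriers.Geometry.Kaehler.MForm.conj_apply (α : MForm 𝓘(ℝ, E) M ℂ k) (x : M) (v : Fin k → TangentSpace 𝓘(ℝ, E) x) :
    α.conj x v = starRingEnd ℂ (α x v) :=
  rfl

@[simp]
theorem _root_.HostAPI.Carriers.Geometry.Kaehler.MForm.conj_conj (α : MForm 𝓘(ℝ, E) M ℂ k) : α.conj.conj = α := by
  funext x; ext v; simp

theorem _root_.HostAPI.Carriers.Geometry.Kaehler.MForm.conj_add (α β : MForm 𝓘(ℝ, E) M ℂ k) : (α + β).conj = α.conj + β.conj := by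
  funext x; ext v; simp

theorem _root_.HostAPI.Carriers.Geometry.Kaehler.MForm.conj_smul (c : ℂ) (α : MForm 𝓘(ℝ, E) M ℂ k) :
    (c • α).conj = starRingEnd ℂ c • α.conj := by
  funext x; ext v; simp

def _root_.HostAPI.Carriers.Geometry.Kaehler.MForm.conjₛₗ (k : ℕ) : MForm 𝓘(ℝ, E) M ℂ k →ₗ⋆[ℂ] MForm 𝓘(ℝ, E) M ℂ k where
  toFun := conj
  map_add' := conj_add
  map_smul' := conj_smul

variable (E M) in

@[simp]
theorem _root_.HostAPI.Carriers.Geometry.Kaehler.MForm.conjₛₗ_apply (α : MForm 𝓘(ℝ, E) M ℂ k) : conjₛₗ (E := E) (M := M) k α = α.conj :=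
  rfl

def _root_.HostAPI.Carriers.Geometry.Kaehler.MForm.ofReal (α : MForm 𝓘(ℝ, E) M ℝ k) : MForm 𝓘(ℝ, E) M ℂ k := fun x ↦
  Complex.ofRealCLM.compContinuousAlternatingMap (α x)

@[simp]
theorem _root_.HostAPI.Carriers.Geometry.Kaehler.MForm.ofReal_apply (α : MForm 𝓘(ℝ, E) M ℝ k) (x : M) (v : Fin k → TangentSpace 𝓘(ℝ, E) x) :
    α.ofReal x v = (α x v : ℂ) :=
  rfl

@[simp]
theorem _root_.HostAPI.Carriers.Geometry.Kaehler.MForm.conj_ofReal (α : MForm 𝓘(ℝ, E) M ℝ k) : α.ofReal.conj = α.ofReal := by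
  funext x; ext v; simp [Complex.conj_ofReal]

theorem _root_.HostAPI.Carriers.Geometry.Kaehler.MForm.ofReal_add (α β : MForm 𝓘(ℝ, E) M ℝ k) : (α + β).ofReal = α.ofReal + β.ofReal := by
  funext x; ext v; simp

theorem _root_.HostAPI.Carriers.Geometry.Kaehler.MForm.ofReal_smul (c : ℝ) (α : MForm 𝓘(ℝ, E) M ℝ k) : (c • α).ofReal = (c : ℂ) • α.ofReal := by
  funext x; ext v; simp

end MForm

theorem IsOfType.conj {p q : ℕ} {α : HostAPI.Carriers.Geometry.Kaehler.MForm 𝓘(ℝ, E) M ℂ k} (hα : IsOfType p q α) :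
    IsOfType q p α.conj := by
  refine ⟨by rw [add_comm]; exact hα.1, fun x θ v ↦ ?_⟩
  rw [HostAPI.Carriers.Geometry.Kaehler.MForm.conj_apply, HostAPI.Carriers.Geometry.Kaehler.MForm.conj_apply, hα.2 x θ v, map_mul, ← Complex.exp_conj]
  congr 2
  simp only [map_mul, Complex.conj_ofReal, Complex.conj_I, ← Complex.ofReal_intCast,
    Complex.conj_ofReal]
  push_cast
  ring

def typeComponent_conj : Prop :=
  ∀ (p q : ℕ) (α : HostAPI.Carriers.Geometry.Kaehler.MForm 𝓘(ℝ, E) M ℂ k),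
    α.conj.typeComponent p q = (α.typeComponent q p).conj

theorem _root_.HostAPI.Carriers.Geometry.Kaehler.MForm.inChart_smul_complex (c : ℂ) (α : HostAPI.Carriers.Geometry.Kaehler.MForm 𝓘(ℝ, E) M ℂ k) (x₀ : M) :
    (c • α).inChart x₀ = c • α.inChart x₀ :=
  rfl

theorem _root_.HostAPI.Carriers.Geometry.Kaehler.IsSmoothForm.smul_complex (c : ℂ) {α : HostAPI.Carriers.Geometry.Kaehler.MForm 𝓘(ℝ, E) M ℂ k} (hα : HostAPI.Carriers.Geometry.Kaehler.IsSmoothForm α) :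
    HostAPI.Carriers.Geometry.Kaehler.IsSmoothForm (c • α) := fun x ↦ by
  rw [HostAPI.Carriers.Geometry.Kaehler.MForm.inChart_smul_complex]
  exact (hα x).const_smul c

theorem _root_.HostAPI.Carriers.Geometry.Kaehler.MForm.inChart_conj (α : HostAPI.Carriers.Geometry.Kaehler.MForm 𝓘(ℝ, E) M ℂ k) (x₀ : M) :
    α.conj.inChart x₀ = fun y ↦ (Complex.conjCLE : ℂ →L[ℝ] ℂ).compContinuousAlternatingMap
      (α.inChart x₀ y) :=
  rfl

theorem isSmoothForm_conj {α : HostAPI.Carriers.Geometry.Kaehler.MForm 𝓘(ℝ, E) M ℂ k} (hα : HostAPI.Carriers.Geometry.Kaehler.IsSmoothForm α) :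
    HostAPI.Carriers.Geometry.Kaehler.IsSmoothForm α.conj := fun x ↦ by
  rw [HostAPI.Carriers.Geometry.Kaehler.MForm.inChart_conj]
  exact ((ContinuousLinearMap.compContinuousAlternatingMapCLM ℝ E ℂ ℂ (Fin k)
    (Complex.conjCLE : ℂ →L[ℝ] ℂ)).contDiff.of_le le_top).comp_contDiffWithinAt (hα x)

def mextDeriv_smul_complex : Prop :=
  ∀ (c : ℂ) (α : HostAPI.Carriers.Geometry.Kaehler.MForm 𝓘(ℝ, E) M ℂ k),
    HostAPI.Carriers.Geometry.Kaehler.mextDeriv (c • α) = c • HostAPI.Carriers.Geometry.Kaehler.mextDeriv α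

def mextDeriv_conj : Prop :=
  ∀ (α : HostAPI.Carriers.Geometry.Kaehler.MForm 𝓘(ℝ, E) M ℂ k),
    HostAPI.Carriers.Geometry.Kaehler.mextDeriv α.conj = (HostAPI.Carriers.Geometry.Kaehler.mextDeriv α).conj

variable (E M) in

def csmoothForms (k : ℕ) : Submodule ℂ (HostAPI.Carriers.Geometry.Kaehler.MForm 𝓘(ℝ, E) M ℂ k) :=
  Submodule.span ℂ (HostAPI.Carriers.Geometry.Kaehler.smoothForms 𝓘(ℝ, E) M ℂ k : Set (HostAPI.Carriers.Geometry.Kaehler.MForm 𝓘(ℝ, E) M ℂ k))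

variable (E M) in

def cclosedSmoothForms (k : ℕ) : Submodule ℂ (HostAPI.Carriers.Geometry.Kaehler.MForm 𝓘(ℝ, E) M ℂ k) :=
  Submodule.span ℂ (HostAPI.Carriers.Geometry.Kaehler.closedSmoothForms 𝓘(ℝ, E) M ℂ k : Set (HostAPI.Carriers.Geometry.Kaehler.MForm 𝓘(ℝ, E) M ℂ k))

variable (E M) in

def cexactSmoothForms : (k : ℕ) → Submodule ℂ (HostAPI.Carriers.Geometry.Kaehler.MForm 𝓘(ℝ, E) M ℂ k)
  | 0 => ⊥
  | k + 1 => Submodule.span ℂ (HostAPI.Carriers.Geometry.Kaehler.mextDeriv '' (csmoothForms E M k : Set (HostAPI.Carriers.Geometry.Kaehler.MForm 𝓘(ℝ, E) M ℂ k)))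

theorem mem_csmoothForms {α : HostAPI.Carriers.Geometry.Kaehler.MForm 𝓘(ℝ, E) M ℂ k} (hα : HostAPI.Carriers.Geometry.Kaehler.IsSmoothForm α) :
    α ∈ csmoothForms E M k :=
  Submodule.subset_span hα

theorem mem_cclosedSmoothForms {α : HostAPI.Carriers.Geometry.Kaehler.MForm 𝓘(ℝ, E) M ℂ k} (hα : HostAPI.Carriers.Geometry.Kaehler.IsSmoothForm α)
    (hc : HostAPI.Carriers.Geometry.Kaehler.IsClosedForm α) : α ∈ cclosedSmoothForms E M k :=
  Submodule.subset_span ⟨hα, hc⟩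

theorem restrictScalars_csmoothForms (k : ℕ) :
    (csmoothForms E M k).restrictScalars ℝ = HostAPI.Carriers.Geometry.Kaehler.smoothForms 𝓘(ℝ, E) M ℂ k := by
  let S : Submodule ℂ (HostAPI.Carriers.Geometry.Kaehler.MForm 𝓘(ℝ, E) M ℂ k) :=
    { carrier := {α | HostAPI.Carriers.Geometry.Kaehler.IsSmoothForm α}
      add_mem' := fun hα hβ ↦ hα.add hβ
      zero_mem' := HostAPI.Carriers.Geometry.Kaehler.isSmoothForm_zero
      smul_mem' := fun c _ hα ↦ hα.smul_complex c }
  have h : csmoothForms E M k = S := by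
    refine le_antisymm (Submodule.span_le.mpr fun α hα ↦ hα) fun α hα ↦ ?_
    exact Submodule.subset_span hα
  ext α
  rw [Submodule.restrictScalars_mem, h]
  rfl

@[simp]
theorem mem_csmoothForms_iff (α : HostAPI.Carriers.Geometry.Kaehler.MForm 𝓘(ℝ, E) M ℂ k) :
    α ∈ csmoothForms E M k ↔ HostAPI.Carriers.Geometry.Kaehler.IsSmoothForm α := by
  rw [← HostAPI.Carriers.Geometry.Kaehler.mem_smoothForms_iff, ← restrictScalars_csmoothForms k, Submodule.restrictScalars_mem]

def restrictScalars_cclosedSmoothForms : Prop :=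
  ∀ (k : ℕ),
    (cclosedSmoothForms E M k).restrictScalars ℝ = HostAPI.Carriers.Geometry.Kaehler.closedSmoothForms 𝓘(ℝ, E) M ℂ k

def restrictScalars_cexactSmoothForms : Prop :=
  ∀ (k : ℕ),
    (cexactSmoothForms E M k).restrictScalars ℝ = HostAPI.Carriers.Geometry.Kaehler.exactSmoothForms 𝓘(ℝ, E) M ℂ k

def cexactSmoothForms_le_cclosedSmoothForms : Prop :=
  ∀ [IsManifold 𝓘(ℝ, E) ∞ M],
    cexactSmoothForms E M k ≤ cclosedSmoothForms E M k

variable (E M) in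

def complexDeRhamCohomology (k : ℕ) : Type _ :=
  ↥(cclosedSmoothForms E M k) ⧸
    (cexactSmoothForms E M k).comap (cclosedSmoothForms E M k).subtype

namespace complexDeRhamCohomology

instance instAddCommGroup : AddCommGroup (complexDeRhamCohomology E M k) :=
  Submodule.Quotient.addCommGroup _

instance instModule : Module ℂ (complexDeRhamCohomology E M k) :=
  Submodule.Quotient.module _

variable (E M) in

def mk (k : ℕ) : cclosedSmoothForms E M k →ₗ[ℂ] complexDeRhamCohomology E M k :=
  Submodule.mkQ _

theorem mk_surjective : Function.Surjective (mk E M k) :=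
  Submodule.mkQ_surjective _

theorem mk_eq_mk_iff (α β : cclosedSmoothForms E M k) :
    mk E M k α = mk E M k β ↔ (α : HostAPI.Carriers.Geometry.Kaehler.MForm 𝓘(ℝ, E) M ℂ k) - β ∈ cexactSmoothForms E M k :=
  (Submodule.Quotient.eq _).trans Iff.rfl

end complexDeRhamCohomology

variable (E M) in

def hodgePQ (k p q : ℕ) : Submodule ℂ (complexDeRhamCohomology E M k) :=
  Submodule.span ℂ (complexDeRhamCohomology.mk E M k ''
    {α : cclosedSmoothForms E M k | IsOfType p q (α : HostAPI.Carriers.Geometry.Kaehler.MForm 𝓘(ℝ, E) M ℂ k)})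

variable (E M) in

def pqForms (p q : ℕ) : Submodule ℂ (HostAPI.Carriers.Geometry.Kaehler.MForm 𝓘(ℝ, E) M ℂ (p + q)) :=
  Submodule.span ℂ {α | HostAPI.Carriers.Geometry.Kaehler.IsSmoothForm α ∧ IsOfType p q α}

theorem mem_pqForms_iff {p q : ℕ} (α : HostAPI.Carriers.Geometry.Kaehler.MForm 𝓘(ℝ, E) M ℂ (p + q)) :
    α ∈ pqForms E M p q ↔ HostAPI.Carriers.Geometry.Kaehler.IsSmoothForm α ∧ IsOfType p q α := by
  let S : Submodule ℂ (HostAPI.Carriers.Geometry.Kaehler.MForm 𝓘(ℝ, E) M ℂ (p + q)) :=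
    { carrier := {α | HostAPI.Carriers.Geometry.Kaehler.IsSmoothForm α ∧ IsOfType p q α}
      add_mem' := fun hα hβ ↦ ⟨hα.1.add hβ.1, hα.2.add hβ.2⟩
      zero_mem' := ⟨HostAPI.Carriers.Geometry.Kaehler.isSmoothForm_zero, isOfType_zero rfl⟩
      smul_mem' := fun c _ hα ↦ ⟨hα.1.smul_complex c, hα.2.smul c⟩ }
  have h : pqForms E M p q = S :=
    le_antisymm (Submodule.span_le.mpr fun α hα ↦ hα) fun α hα ↦ Submodule.subset_span hα
  rw [h]
  rfl

theorem hodgePQ_eq_bot_of_ne {p q : ℕ} (h : p + q ≠ k) : hodgePQ E M k p q = ⊥ := by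
  rw [hodgePQ, Submodule.span_eq_bot]
  rintro _ ⟨α, hα, rfl⟩
  exact absurd hα.1 h

section Holomorphic

variable [IsManifold 𝓘(ℂ, E) ω M] [IsManifold 𝓘(ℝ, E) ∞ M]

def isSmoothForm_typeComponent : Prop :=
  ∀ (p q : ℕ) {α : HostAPI.Carriers.Geometry.Kaehler.MForm 𝓘(ℝ, E) M ℂ k} (hα : HostAPI.Carriers.Geometry.Kaehler.IsSmoothForm α),
    HostAPI.Carriers.Geometry.Kaehler.IsSmoothForm (α.typeComponent p q)

set_option linter.overlappingInstances false in

def isSmoothForm_weightComponent [IsManifold 𝓘(ℂ, E) ω M] [IsManifold 𝓘(ℝ, E) ∞ M] : Prop :=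
  ∀ (w : ℤ) {α : HostAPI.Carriers.Geometry.Kaehler.MForm 𝓘(ℝ, E) M ℂ k} (hα : HostAPI.Carriers.Geometry.Kaehler.IsSmoothForm α),
    HostAPI.Carriers.Geometry.Kaehler.IsSmoothForm (α.weightComponent w)

set_option linter.overlappingInstances false in

def typeComponent_mem_pqForms [IsManifold 𝓘(ℂ, E) ω M] [IsManifold 𝓘(ℝ, E) ∞ M] : Prop :=
  ∀ {p q : ℕ} {α : HostAPI.Carriers.Geometry.Kaehler.MForm 𝓘(ℝ, E) M ℂ (p + q)} (hα : HostAPI.Carriers.Geometry.Kaehler.IsSmoothForm α),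
    α.typeComponent p q ∈ pqForms E M p q

def conj_mem_cclosedSmoothForms : Prop :=
  ∀ {α : HostAPI.Carriers.Geometry.Kaehler.MForm 𝓘(ℝ, E) M ℂ k} (hα : α ∈ cclosedSmoothForms E M k),
    α.conj ∈ cclosedSmoothForms E M k

def conj_mem_cexactSmoothForms : Prop :=
  ∀ {α : HostAPI.Carriers.Geometry.Kaehler.MForm 𝓘(ℝ, E) M ℂ k} (hα : α ∈ cexactSmoothForms E M k),
    α.conj ∈ cexactSmoothForms E M k

def conj_hodgePQ : Prop :=
  ∀ (k p q : ℕ),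
    (((hodgePQ E M k p q).comap (complexDeRhamCohomology.mk E M k)).map
        (cclosedSmoothForms E M k).subtype).map (HostAPI.Carriers.Geometry.Kaehler.MForm.conjₛₗ k) =
      ((hodgePQ E M k q p).comap (complexDeRhamCohomology.mk E M k)).map
        (cclosedSmoothForms E M k).subtype

end Holomorphic

end HostAPI.Carriers.NumberTheory.Transcendental
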